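import Summits.RiemannHypothesis.RiemannHypothesis.Theses.RuelleBand
import Summits.RiemannHypothesis.RiemannHypothesis.Theorems.RuelleBandCofiniteCriticalLineBoundedIndexIff
import Literature.NumberTheory.LFunctions.WeilSemilocalCompactnessProofs

/-!
# Crux idea `bandlimited-symbol-census` (crux stmt-RiemannHypothesis-2064, round 2, ideator 5) —
first lemmas TYPED (not proved) over existing declarations.

Dictionary.  For a Weil test `g` supported in `[-a, a]` write `F(t) = ĝ(1/2 + it) = weilMellin g (1/2 + tI)`
(the Fourier transform of `g`).  Weil's window form is the Paley–Wiener compression of an explicit REAL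
multiplication symbol:

  `Re Q(g) = (1/2π) ∫ |F(t)|² · M_a(t) dt`,
  `M_a(t) = Re ψ(1/4 + it/2) − log π + P_a(t) − Ṽ_a(t)`,

where `P_a` is the Fourier transform of `e^{-|x|/2}` on `|x| < 2a` (polar term minus its PNT main part) and
`Ṽ_a(t) = 2 Re[ Σ_{n < e^{2a}} Λ(n) n^{-1/2-it} − (e^{2a(1/2−it)} − 1)/(1/2 − it) ]` is the Fourier–Stieltjes
transform of the normalised PNT-error measure `e^{-x/2} d(ψ(eˣ) − eˣ)` on `(0, 2a)`, symmetrised.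
Numerically verified for `a = 1` to `3·10⁻¹²` (folder `num/symbol_check.py`).

The LEVER is `IndexLeWellMeasure`: the negative index of the window form is at most
`(1 + B_a)(a/π) · meas{t : M_a(t) < 1}` (Bessel's inequality for an `L²`-orthonormal negative family against
the characters `e^{itx} 1_{[-a,a]}`, after the observation that a negative direction carries at least the
fraction `1/(1+B_a)` of its spectral mass inside the well set).
-/

noncomputable section

open Complex MeasureTheory Set
open scoped Real ArithmeticFunction.vonMangoldt

namespace Summit.RiemannHypothesis.RiemannHypothesis.Cruxes.CofiniteCriticalLine.SymbolCensus

open Literature.NumberTheory.LFunctions Literature.Analysis.SpecialFunctions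
open Summit.RiemannHypothesis.RiemannHypothesis.Theses.RuelleBand

/-- Band-limited polar symbol `P_a(t) = 2 Re[(1 − e^{−2a(1/2+it)})/(1/2+it)]`
(Fourier transform of `x ↦ e^{-|x|/2}` restricted to `|x| < 2a`). -/
def polarSymbol (a t : ℝ) : ℝ :=
  2 * ((1 - cexp (-(2 * a : ℂ) * (1 / 2 + t * I))) / (1 / 2 + t * I)).re

/-- The prime polynomial `D_a(t) = Σ_{n ≤ e^{2a}} Λ(n) n^{-1/2} n^{-it}` (a finite trigonometric polynomial in `t`
with frequencies `log n`; `n^{-it}` written as `exp(−i t log n)` to avoid `cpow` junk at `n = 0`). -/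
def primePoly (a t : ℝ) : ℂ :=
  ∑ n ∈ Finset.range (⌊Real.exp (2 * a)⌋₊ + 1),
    ((Λ n : ℝ) : ℂ) / (Real.sqrt n : ℂ) * cexp (-((t * Real.log n : ℝ) : ℂ) * I)

/-- The PNT compensator `(e^{2a(1/2−it)} − 1)/(1/2 − it) = ∫₀^{2a} e^{x(1/2−it)} dx`. -/
def pntCompensator (a t : ℝ) : ℂ :=
  (cexp ((2 * a : ℂ) * (1 / 2 - t * I)) - 1) / (1 / 2 - t * I)

/-- `Ṽ_a(t)`: Fourier–Stieltjes transform of the normalised, symmetrised PNT-error measure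
`e^{-|x|/2} d(ψ(e^{|x|}) − e^{|x|})` on `|x| < 2a`. -/
def pntErrorSymbol (a t : ℝ) : ℝ :=
  2 * (primePoly a t - pntCompensator a t).re

/-- The band-limited Weil symbol `M_a(t) = Re ψ(1/4 + it/2) − log π + P_a(t) − Ṽ_a(t)`. -/
def weilSymbol (a t : ℝ) : ℝ :=
  reDigammaQuarter t - Real.log π + polarSymbol a t - pntErrorSymbol a t

/-- FIRST LEMMA (symbol identity): for a Weil test `g` supported in `[-a, a]`,
`Re Q(g) = (1/2π) ∫ |ĝ(1/2+it)|² M_a(t) dt`.  (Exact; the three pieces are the tree's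
`weilArchIntegral_weilConv_weilReflect`, `weilPolarTerm_weilConv_weilReflect` and the prime term rewritten
through `(g ⋆ g̃)(x) = (1/2π) ∫ |ĝ(1/2+it)|² e^{-itx} dt`.) -/
def SymbolIdentity : Prop :=
  ∀ a : ℝ, 0 < a → ∀ g : ℝ → ℂ, IsWeilTest g → tsupport g ⊆ Icc (-a) a →
    (weilQuadratic g).re = 1 / (2 * π) * ∫ t : ℝ, ‖weilMellin g (1 / 2 + t * I)‖ ^ 2 * weilSymbol a t

/-- "The window form on `[-a, a]` has negative index `≤ N`" — verbatim the shape of the certified interface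
`boundedWeilIndex_iff_cofiniteCriticalLine` and of `stub_windowIndexFinite`. -/
def WindowIndexLE (a : ℝ) (N : ℕ) : Prop :=
  ∀ g : Fin (N + 1) → ℝ → ℂ, (∀ i, IsWeilTest (g i)) → (∀ i, tsupport (g i) ⊆ Icc (-a) a) →
    ∃ c : Fin (N + 1) → ℂ, c ≠ 0 ∧ 0 ≤ (weilQuadratic (fun t => ∑ i, c i * g i t)).re

/-- The WELL SET of the window: heights where the symbol dips below the margin `1`. -/
def wellSet (a : ℝ) : Set ℝ := {t : ℝ | weilSymbol a t < 1}

/-- THE LEVER (index ≤ depth × window × measure of wells): if `M_a ≥ −B` everywhere (`B ≥ 0`) and the well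
set has finite measure, then every `L²`-orthonormal family of window tests on which `Re Q` is negative has at
most `(1 + B)(a/π)·meas(wellSet a)` members; hence `WindowIndexLE a N` as soon as that quantity is `≤ N`.
(Proof sketch: a negative direction `g` has `∫_{wells} |ĝ|² ≥ (2π/(1+B)) ‖g‖₂²` by `SymbolIdentity`; summing over
an orthonormal negative family and using Bessel's inequality `Σᵢ |ĝᵢ(1/2+it)|² ≤ ‖e^{it·} 1_{[-a,a]}‖² = 2a`
pointwise in `t` bounds the family size.) -/
def IndexLeWellMeasure : Prop :=
  ∀ a : ℝ, 0 < a → ∀ B : ℝ, 0 ≤ B → (∀ t : ℝ, -B ≤ weilSymbol a t) →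
    volume (wellSet a) ≠ ⊤ →
    ∀ N : ℕ, (1 + B) * (a / π) * (volume (wellSet a)).toReal ≤ N → WindowIndexLE a N

/-- HEIGHT LOCALISATION of negative directions (tier T1, unconditional, explicit): a window test with
`Re Q(g) < 0` carries at least half of its spectral mass below the doubly-exponential height `exp(C·eᵃ)`
(trivial bound `|Ṽ_a| ≤ 8.2 eᵃ + 4` from `ψ(x) ≤ 1.04 x`, against `Re ψ(1/4+it/2) = log(1+|t|/2) + O(1)`,
tree: `exists_le_reDigammaQuarter_of_le_abs`, `weilArchIntegral_le_weilQuadratic_re`). -/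
def HeightLocalisation : Prop :=
  ∃ C : ℝ, ∀ a : ℝ, 1 ≤ a → ∀ g : ℝ → ℂ, IsWeilTest g → tsupport g ⊆ Icc (-a) a →
    (weilQuadratic g).re < 0 →
      ∫ t : ℝ, ‖weilMellin g (1 / 2 + t * I)‖ ^ 2 ≤
        2 * ∫ t in Icc (-Real.exp (C * Real.exp a)) (Real.exp (C * Real.exp a)),
          ‖weilMellin g (1 / 2 + t * I)‖ ^ 2

/-- Tier T1 consequence (new, unconditional, M-sized over the tree): the window index is at most doubly
exponential in the window, `κ(a) ≤ exp(C eᵃ)` — the QUANTITATIVE form of Yoshida / CCM 2025 Thm 3.6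
(in tree only qualitatively: `stub_windowIndexFinite`). -/
def ExplicitWindowIndexBound : Prop :=
  ∃ C : ℝ, ∀ a : ℝ, 1 ≤ a → ∀ N : ℕ, Real.exp (C * Real.exp a) ≤ N → WindowIndexLE a N

/-- Tier T2 target (conditional on Gaussian large-value tails for the prime polynomial `D_a` at level
`¼ log t`, i.e. Montgomery's large-value philosophy for prime-supported coefficients): the total measure of the
well set is `≤ exp(C a²)`, so `κ(a) ≤ exp(C' a²)`.  Stated as the measure bound it needs. -/
def WellMeasureGaussian : Prop :=
  ∃ C : ℝ, ∀ a : ℝ, 1 ≤ a → volume (wellSet a) ≠ ⊤ ∧ (volume (wellSet a)).toReal ≤ Real.exp (C * a ^ 2)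

/-- Wiring to the crux through the CERTIFIED interface (p111167): a uniform window-index bound closes the crux.
(The symbol census alone cannot supply uniformity — see the card's honesty clause: under RH the well measure
still grows like `exp(c a²)`; tier T3 = telling subcritical from supercritical wells = the arithmetic.) -/
theorem crux_of_uniformWindowIndex (h : ∃ N : ℕ, ∀ a : ℝ, WindowIndexLE a N) : CofiniteCriticalLine :=
  Summit.RiemannHypothesis.RiemannHypothesis.Theorems.RuelleBandCofiniteCriticalLine.boundedWeilIndex_iff_cofiniteCriticalLine.mp
    h

/-- Composition of the lever with a uniform well budget (a deliberately FALSE-under-RH hypothesis, recorded to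
make the gap explicit: `UniformWellBudget` fails because wells are abundant though subcritical). -/
theorem windowIndexLE_of_budget (hL : IndexLeWellMeasure) {K : ℕ}
    (hB : ∀ a : ℝ, 0 < a → ∃ B : ℝ, 0 ≤ B ∧ (∀ t, -B ≤ weilSymbol a t) ∧ volume (wellSet a) ≠ ⊤ ∧
      (1 + B) * (a / π) * (volume (wellSet a)).toReal ≤ K) :
    ∀ a : ℝ, 0 < a → WindowIndexLE a K := by
  intro a ha
  obtain ⟨B, hB0, hBM, hfin, hbud⟩ := hB a ha
  exact hL a ha B hB0 hBM hfin K hbud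

end Summit.RiemannHypothesis.RiemannHypothesis.Cruxes.CofiniteCriticalLine.SymbolCensus

end
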